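import Mathlib.Data.Nat.Choose.Bounds
import Literature.Computability.AlgebraicComplexity.RazElusiveGeneralDefinable
import HarnessLib

/-!
# A poly(`n`)-definable polynomial `f̃` carrying a poly(`n`)-definable mapping `f : Fⁿ → F^m`
# in its coefficients, by binary blocks (the rôle of Raz 2010, §3.3, Prop. 3.5 and Prop. 3.6)

R. Raz, *Elusive functions and lower bounds for arithmetic circuits*, Theory of Computing 6
(2010) 135–177, §3.3: from a polynomial mapping `f = (f₁, …, f_m) : Fⁿ → F^m`,
`m = n · C(n+r-1, r)`, Raz forms `f̃ = ∑ᵢ wᵢ ∑_{q ∈ M_r} f_{(h(q), i)}(x) · q(z) ∈ F[X, Z, W]`,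
`h` the lexicographic order of the degree-`r` monomials `M_r` in `z₁, …, zₙ`, and shows
(Prop. 3.5) that after `x := a` the coefficient vector of `f̃|_a` is `f(a)`, and (Prop. 3.6) that
`f̃` is poly(`n`)-definable when `f` is, the proof of the latter resting on a poly(`n`)-size
Boolean circuit generating "a description of the monomial `h⁻¹(j)`" from the bits of `j`
(lexicographic unranking; in the tree this step is the named fact `Raz2010_monomialCircuits` of
`RazElusiveGeneralDefinable.lean`).

For the route to lower bounds (Cor. 3.8/3.9) only three properties of `f̃` matter: it is a `VNP`
family; every `f_idx(a)` is the coefficient of a fixed degree-`r` monomial `Z_idx` of `f̃|_a`,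
distinct indices giving distinct monomials; and `f̃|_a` is homogeneous of degree `r` in `z`.
This file constructs a polynomial `f̃` with these three properties by a DIFFERENT, circuit-free
encoding of the index, so that Prop. 3.6 becomes an explicit polynomial identity: the flat index
`idx < 2^K` (`K = ⌈log₂ m⌉` bits, as in Def. 1.3) is cut into `R = r` blocks of `β` bits,
block `t` selecting one of `2^β` fresh variables `z_{(t, c)}`, and
`f̃ = ∑_{idx < 2^K} f_idx(x) · ∏_{t < r} z_{(t, block_t(idx))}` (coordinates `f_idx` for
`idx ≥ m` being the junk values of the Def. 1.3 witness). The `VNP` witness is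
`g(x, e, w) · SEL(w, z)` with the selector
`SEL = ∏_{t<r} ∑_{c < 2^β} (∏_{l<β} [bit_l(c) ? w_{tβ+l} : 1 - w_{tβ+l}]) · z_{(t,c)}`, an
explicit polynomial of size `O(r 2^β β)`; with `β = 2⌈log₂ 2n⌉` one has `2^β ≤ 16 n² + 1` and
`r β ≥ K` whenever `1 ≤ r ≤ n` (`RazBlocks.clog_index_le`), so that the encoding is injective
(`RazBlocks.zexpZ_injective`). Thus no unranking of monomials is needed; the price is that
`f̃|_a` lives in `r · 2^β ≤ 16 n³ + n` variables instead of Raz's `n`, which is immaterial for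
the super-polynomial conclusion of Cor. 3.9 (the universal circuit of `RazUniversalCircuits.lean`
is polynomial in the number of variables).

## Contents (namespace `RazBlocks`)

* bit vectors (on top of `RazDefinable.bitVec`): `bitEquiv`, `bbit`, `digit`, `sum_assign_split`;
* one level (`n, R, β, ℓ, K, Kw` raw parameters, `g ∈ F[x, e, w]` a Def. 1.3 witness with `Kw`
  index variables): `wlit`, `ind`, `sel`, `ρ`, `witness g = g(x, e, w) · SEL`,
  `tilde g = boolSum (witness g)`; the exponent `zexpZ idx` of `Z_idx`;
* **the identity** `tilde_eq_sum`:
  `tilde g = ∑_{idx < 2^K} (∑ₑ g(x, e, bits idx)) · Z_idx` (the rôle of Prop. 3.6: `f̃` IS a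
  Boolean sum of a small polynomial, by construction, and its coefficients are the `f_idx`);
* `aeval_blockSum_eq`, `coeff_zexpZ_blockSumAt`, `isHomogeneous_blockSumAt` (the rôle of
  Prop. 3.5: `f̃|_a ∈ 𝕄_r` and its `Z_idx`-coefficient is `f_idx(a)`), over any commutative
  semiring (used after base change to an extension field);
* size: `complexity_witness_le`, `totalDegree_witness_le`, and the parameter estimates
  `two_pow_clog_le`, `clog_index_le`.

## References

* R. Raz, *Elusive functions and lower bounds for arithmetic circuits*, Theory of Computing 6
  (2010) 135–177: Def. 1.3 (p. 142), §3.3 (pp. 159–161: `f̃`, Prop. 3.5, Prop. 3.6).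
* P. Bürgisser, *Completeness and Reduction in Algebraic Complexity Theory*, Springer 2000,
  Def. 2.5 (Valiant's Boolean sum, the tree's `boolSum`).
-/

noncomputable section

open MvPolynomial

namespace Literature.Computability.AlgebraicComplexity

namespace RazBlocks

universe u

/-! ### Bit vectors

The bits `bitVec K i : Fin K → Bool` of an index, the bijection `Fin (2^K) → (Fin K → Bool)`
and the reindexing of Boolean sums are those of `RazElusiveGeneralDefinable.lean`
(`RazDefinable.bitVec`, `RazDefinable.bitVec_injOn`, `RazDefinable.bitVec_bijective`,
`RazDefinable.sum_boolVec_eq_sum_fin`). -/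

open RazDefinable (bitVec bitVec_injOn bitVec_bijective sum_boolVec_eq_sum_fin)

section Bits

/-- The bijection `Fin (2^K) ≃ (Fin K → Bool)`, `i ↦ bits of i`. [folklore] -/
def bitEquiv (K : ℕ) : Fin (2 ^ K) ≃ (Fin K → Bool) :=
  Equiv.ofBijective _ (bitVec_bijective K)

/-- Unfolding `bitEquiv`. [folklore] -/
@[simp] theorem bitEquiv_apply (K : ℕ) (i : Fin (2 ^ K)) (t : Fin K) :
    bitEquiv K i t = (i : ℕ).testBit t := rfl

/-- Splitting a sum over assignments of `Fin (ℓ + K)` Boolean variables into the first `ℓ` and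
the last `K` of them. [folklore] -/
theorem sum_assign_split {M : Type*} [AddCommMonoid M] (ℓ K : ℕ)
    (Φ : (Fin ℓ → Bool) → (Fin K → Bool) → M) :
    ∑ E : Fin (ℓ + K) → Bool, Φ (fun j => E (Fin.castAdd K j)) (fun t => E (Fin.natAdd ℓ t)) =
      ∑ e : Fin ℓ → Bool, ∑ b : Fin K → Bool, Φ e b := by
  rw [← Fintype.sum_prod_type']
  refine Fintype.sum_equiv (((Equiv.arrowCongr finSumFinEquiv (Equiv.refl Bool)).symm).trans
    (Equiv.sumArrowEquivProdArrow (Fin ℓ) (Fin K) Bool)) _ _ fun E => ?_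
  rfl

variable {K : ℕ}

/-- Bit number `i` of an index given by its `K` low bits (`false` beyond `K`). [folklore] -/
def bbit (b : Fin K → Bool) (i : ℕ) : Bool :=
  if h : i < K then b ⟨i, h⟩ else false

/-- For `idx < 2^K`, `bbit (bits of idx) i` is the `i`-th bit of `idx`, for every `i`.
[folklore] -/
theorem bbit_bitVec {idx : ℕ} (hidx : idx < 2 ^ K) (i : ℕ) :
    bbit (bitVec K idx) i = idx.testBit i := by
  unfold bbit bitVec
  split_ifs with h
  · rfl
  · exact (Nat.testBit_lt_two_pow (hidx.trans_le
      (Nat.pow_le_pow_right (by norm_num) (not_lt.1 h)))).symm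

/-- The `t`-th block of `β` bits of an index, as a number `< 2^β` (block `t` consists of the bits
number `tβ, …, tβ + β - 1`). [folklore] -/
def digit (β : ℕ) (b : Fin K → Bool) (t : ℕ) : Fin (2 ^ β) :=
  (bitEquiv β).symm fun l => bbit b (t * β + l)

/-- The bits of the `t`-th block. [folklore] -/
theorem testBit_digit (β : ℕ) (b : Fin K → Bool) (t : ℕ) {l : ℕ} (hl : l < β) :
    (digit β b t : ℕ).testBit l = bbit b (t * β + l) := by
  have h := congrFun ((bitEquiv β).apply_symm_apply fun l : Fin β => bbit b (t * β + l)) ⟨l, hl⟩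
  rw [bitEquiv_apply] at h
  exact h

/-- A number `c < 2^β` is the `t`-th block iff its bits are the bits of the block. [folklore] -/
theorem eq_digit_iff {β : ℕ} (b : Fin K → Bool) (t : ℕ) (c : Fin (2 ^ β)) :
    c = digit β b t ↔ ∀ l : Fin β, (c : ℕ).testBit l = bbit b (t * β + l) := by
  constructor
  · rintro rfl l
    exact testBit_digit β b t l.isLt
  · intro h
    apply (bitEquiv β).injective
    funext l
    rw [bitEquiv_apply, h l, ← testBit_digit β b t l.isLt, ← bitEquiv_apply]

/-- If `K ≤ R β`, an index `< 2^K` is determined by its first `R` blocks. [folklore] -/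
theorem bitVec_eq_of_digit_eq {β R : ℕ} (hK : K ≤ R * β) {b b' : Fin K → Bool}
    (h : ∀ t < R, digit β b t = digit β b' t) : b = b' := by
  funext ⟨i, hi⟩
  rcases Nat.eq_zero_or_pos β with hβ | hβ
  · subst hβ; omega
  have ht : i / β < R := (Nat.div_lt_iff_lt_mul hβ).2 (by omega)
  have k1 := testBit_digit β b (i / β) (Nat.mod_lt i hβ)
  have k2 := testBit_digit β b' (i / β) (Nat.mod_lt i hβ)
  rw [h (i / β) ht, k2, Nat.div_add_mod'] at k1
  simpa [bbit, hi] using k1.symm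

end Bits


/-! ### One level of the construction -/

section OneLevel

variable {F : Type u} [CommRing F]
variable (n R β ℓ K Kw : ℕ)

/-- The variables of `f̃`: `x_i` (`Sum.inl i`, `i < n`) and `z_{(t, c)}` (`Sum.inr (t, c)`,
`t < R` the block, `c < 2^β` its value). [cite: Raz2010, §3.3 (p. 159)] -/
abbrev XZ : Type := Fin n ⊕ (Fin R × Fin (2 ^ β))

/-- The variables of the `VNP` witness: those of `f̃` and the Boolean block `e₁, …, e_ℓ`
(`Fin.castAdd K j`) followed by the index bits `w₁, …, w_K` (`Fin.natAdd ℓ t`).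
[cite: Raz2010, Def. 1.3 (p. 142)] -/
abbrev WV : Type := XZ n R β ⊕ Fin (ℓ + K)

variable (F)

/-- The Boolean variable of index bit number `i`, or `0` beyond `K`. [folklore] -/
def wlit (i : ℕ) : MvPolynomial (WV n R β ℓ K) F :=
  if h : i < K then X (Sum.inr (Fin.natAdd ℓ ⟨i, h⟩)) else 0

/-- The indicator polynomial of "block `t` of the index has value `c`":
`∏_{l<β} [bit_l(c) ? w_{tβ+l} : 1 - w_{tβ+l}]`. [folklore] -/
def ind (t : Fin R) (c : Fin (2 ^ β)) : MvPolynomial (WV n R β ℓ K) F :=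
  ∏ l : Fin β, if (c : ℕ).testBit l then wlit F n R β ℓ K (t * β + l)
    else 1 - wlit F n R β ℓ K (t * β + l)

/-- The selector `SEL = ∏_{t<R} ∑_{c<2^β} IND_{t,c} · z_{(t,c)}`: on the bits of `idx` it
evaluates to the monomial `Z_idx = ∏_t z_{(t, block_t(idx))}`. [folklore] -/
def sel : MvPolynomial (WV n R β ℓ K) F :=
  ∏ t : Fin R, ∑ c : Fin (2 ^ β), ind F n R β ℓ K t c * X (Sum.inl (Sum.inr (t, c)))

/-- The substitution feeding the Def. 1.3 witness `g(x, e, w)` (with `Kw` index variables) from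
the variables of the `VNP` witness: `x ↦ x`, `e ↦ e`, `w_t ↦ w_t` (or `0` if `t ≥ K`).
[cite: Raz2010, Def. 1.3 (p. 142)] -/
def ρ : (Fin n ⊕ Fin ℓ) ⊕ Fin Kw → MvPolynomial (WV n R β ℓ K) F
  | Sum.inl (Sum.inl i) => X (Sum.inl (Sum.inl i))
  | Sum.inl (Sum.inr j) => X (Sum.inr (Fin.castAdd K j))
  | Sum.inr t => wlit F n R β ℓ K t

variable {F} in
/-- **The `VNP` witness** `g(x, e, w) · SEL(w, z)`. [cite: Raz2010, Prop. 3.6 (p. 160)] -/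
def witness (g : MvPolynomial ((Fin n ⊕ Fin ℓ) ⊕ Fin Kw) F) : MvPolynomial (WV n R β ℓ K) F :=
  aeval (ρ F n R β ℓ K Kw) g * sel F n R β ℓ K

variable {F} in
/-- **The polynomial `f̃`** (binary-block variant of Raz 2010, §3.3): the Boolean sum of the
witness over `e` and the index bits `w`. [cite: Raz2010, §3.3 (p. 159), Prop. 3.6 (p. 160)] -/
def tilde (g : MvPolynomial ((Fin n ⊕ Fin ℓ) ⊕ Fin Kw) F) : MvPolynomial (XZ n R β) F :=
  boolSum (witness n R β ℓ K Kw g)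

/-- The exponent vector of the monomial `Z_idx = ∏_{t<R} z_{(t, block_t(idx))}` selected by the
index bits `b`. [cite: Raz2010, §3.3 (p. 159)] -/
def zexpZ (b : Fin K → Bool) : (Fin R × Fin (2 ^ β)) →₀ ℕ :=
  ∑ t : Fin R, Finsupp.single (t, digit β b t) 1

/-- The monomial `Z_idx` as a polynomial in all the variables of `f̃`.
[cite: Raz2010, §3.3 (p. 159)] -/
def zmon (b : Fin K → Bool) : MvPolynomial (XZ n R β) F :=
  rename Sum.inr (monomial (zexpZ R β K b) 1)

/-! #### Semantics of the witness under a Boolean assignment -/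

/-- The Boolean substitution of Valiant's `boolSum` for an assignment `E` of the Boolean block.
[cite: Burgisser2000, Def. 2.5] -/
def SB (E : Fin (ℓ + K) → Bool) : WV n R β ℓ K → MvPolynomial (XZ n R β) F :=
  Sum.elim X fun j => if E j then 1 else 0

/-- The constant `[x] ∈ {0, 1}`. [folklore] -/
def bconst (x : Bool) : MvPolynomial (XZ n R β) F :=
  if x then 1 else 0

/-- `boolSum` unfolded. [cite: Burgisser2000, Def. 2.5] -/
theorem boolSum_eq_sum_SB (G : MvPolynomial (WV n R β ℓ K) F) :
    boolSum G = ∑ E : Fin (ℓ + K) → Bool, aeval (SB F n R β ℓ K E) G :=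
  rfl

/-- The index bits of an assignment: its last `K` Boolean values. [folklore] -/
def bE (E : Fin (ℓ + K) → Bool) : Fin K → Bool := fun t => E (Fin.natAdd ℓ t)

/-- The `e`-part of an assignment: its first `ℓ` Boolean values. [folklore] -/
def eE (E : Fin (ℓ + K) → Bool) : Fin ℓ → Bool := fun j => E (Fin.castAdd K j)

omit [CommRing F] in
/-- Splitting the Boolean sum into its `e`-part and its index bits. [folklore] -/
theorem sum_assign_split' {M : Type*} [AddCommMonoid M]
    (Φ : (Fin ℓ → Bool) → (Fin K → Bool) → M) :
    ∑ E : Fin (ℓ + K) → Bool, Φ (eE ℓ K E) (bE ℓ K E) = ∑ e : Fin ℓ → Bool, ∑ b : Fin K → Bool, Φ e b :=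
  sum_assign_split ℓ K Φ

/-- A bit literal evaluates to the bit. [folklore] -/
theorem aeval_SB_wlit (E : Fin (ℓ + K) → Bool) (i : ℕ) :
    aeval (SB F n R β ℓ K E) (wlit F n R β ℓ K i) = bconst F n R β (bbit (bE ℓ K E) i) := by
  unfold wlit bbit bE bconst
  split_ifs with h h' h' <;> simp_all [SB]

/-- The block indicator evaluates to `[c = block_t]`. [folklore] -/
theorem aeval_SB_ind (E : Fin (ℓ + K) → Bool) (t : Fin R) (c : Fin (2 ^ β)) :
    aeval (SB F n R β ℓ K E) (ind F n R β ℓ K t c) =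
      if c = digit β (bE ℓ K E) t then 1 else 0 := by
  unfold ind
  rw [map_prod]
  have hfac : ∀ l : Fin β, aeval (SB F n R β ℓ K E)
      (if (c : ℕ).testBit l then wlit F n R β ℓ K (t * β + l)
        else 1 - wlit F n R β ℓ K (t * β + l)) =
      if (c : ℕ).testBit l = bbit (bE ℓ K E) (t * β + l) then 1 else 0 := by
    intro l
    split_ifs with h1 h2 h2
    · rw [aeval_SB_wlit, ← h2, h1]; rfl
    · rw [aeval_SB_wlit]
      have : bbit (bE ℓ K E) (t * β + l) = false := by
        cases hb : bbit (bE ℓ K E) (t * β + l) <;> simp_all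
      rw [this]; rfl
    · rw [map_sub, map_one, aeval_SB_wlit, ← h2]
      simp [bconst, h1]
    · rw [map_sub, map_one, aeval_SB_wlit]
      have : bbit (bE ℓ K E) (t * β + l) = true := by
        cases hb : bbit (bE ℓ K E) (t * β + l) <;> simp_all
      rw [this]
      simp [bconst]
  simp only [hfac]
  by_cases hc : c = digit β (bE ℓ K E) t
  · rw [if_pos hc]
    refine Finset.prod_eq_one fun l _ => ?_
    rw [if_pos ((eq_digit_iff _ _ _).1 hc l)]
  · rw [if_neg hc]
    obtain ⟨l, hl⟩ : ∃ l : Fin β, (c : ℕ).testBit l ≠ bbit (bE ℓ K E) (t * β + l) := by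
      by_contra hcon
      push Not at hcon
      exact hc ((eq_digit_iff _ _ _).2 hcon)
    exact Finset.prod_eq_zero (Finset.mem_univ l) (if_neg hl)

/-- A product of distinct `z`-variables is the monomial `Z`. [folklore] -/
theorem prod_X_eq_zmon (b : Fin K → Bool) :
    ∏ t : Fin R, (X (Sum.inr (t, digit β b t)) : MvPolynomial (XZ n R β) F) = zmon F n R β K b := by
  unfold zmon zexpZ
  rw [rename_monomial, Finsupp.mapDomain_finsetSum, monomial_sum_one]
  refine Finset.prod_congr rfl fun t _ => ?_
  rw [Finsupp.mapDomain_single]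
  rfl

/-- The selector evaluates to the selected monomial: `SEL(bits) = Z_idx`. [folklore] -/
theorem aeval_SB_sel (E : Fin (ℓ + K) → Bool) :
    aeval (SB F n R β ℓ K E) (sel F n R β ℓ K) = zmon F n R β K (bE ℓ K E) := by
  unfold sel
  rw [map_prod, ← prod_X_eq_zmon]
  refine Finset.prod_congr rfl fun t _ => ?_
  rw [map_sum]
  simp only [map_mul, aeval_SB_ind, aeval_X]
  simp only [SB, Sum.elim_inl, boole_mul]
  rw [Finset.sum_ite_eq' Finset.univ (digit β (bE ℓ K E) t), if_pos (Finset.mem_univ _)]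

/-- The substitution `x ↦ x`, `e ↦ [e_j]`, `w_t ↦ [bit_t]` of the Def. 1.3 witness determined by
Boolean values `e` and index bits `b`. [cite: Raz2010, Def. 1.3 (p. 142)] -/
def θ (e : Fin ℓ → Bool) (b : Fin K → Bool) : (Fin n ⊕ Fin ℓ) ⊕ Fin Kw → MvPolynomial (XZ n R β) F
  | Sum.inl (Sum.inl i) => X (Sum.inl i)
  | Sum.inl (Sum.inr j) => bconst F n R β (e j)
  | Sum.inr t => bconst F n R β (bbit b t)

/-- Under the Boolean substitution the fed witness `g(ρ)` becomes `g(x, [e], [bits])`.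
[cite: Raz2010, Def. 1.3 (p. 142)] -/
theorem aeval_SB_aeval_ρ (E : Fin (ℓ + K) → Bool) (g : MvPolynomial ((Fin n ⊕ Fin ℓ) ⊕ Fin Kw) F) :
    aeval (SB F n R β ℓ K E) (aeval (ρ F n R β ℓ K Kw) g) =
      aeval (θ F n R β ℓ K Kw (eE ℓ K E) (bE ℓ K E)) g := by
  have hfun : (fun v => aeval (SB F n R β ℓ K E) (ρ F n R β ℓ K Kw v)) =
      θ F n R β ℓ K Kw (eE ℓ K E) (bE ℓ K E) := by
    funext v
    rcases v with (i | j) | t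
    · simp [ρ, SB, θ]
    · simp [ρ, SB, θ, eE, bconst]
    · simp only [ρ, θ]
      exact aeval_SB_wlit F n R β ℓ K E t
  rw [← AlgHom.comp_apply, comp_aeval, hfun]

/-- **`f̃` as a sum over the indices**, Boolean-vector form: `f̃ = ∑_b (∑ₑ g(x,[e],[b])) · Z_b`.
[cite: Raz2010, §3.3 (p. 159), Prop. 3.6 (p. 161)] -/
theorem tilde_eq_sum_boolVec (g : MvPolynomial ((Fin n ⊕ Fin ℓ) ⊕ Fin Kw) F) :
    tilde n R β ℓ K Kw g =
      ∑ b : Fin K → Bool, (∑ e : Fin ℓ → Bool, aeval (θ F n R β ℓ K Kw e b) g) * zmon F n R β K b := by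
  unfold tilde witness
  rw [boolSum_eq_sum_SB]
  simp only [map_mul, aeval_SB_aeval_ρ, aeval_SB_sel]
  rw [sum_assign_split' ℓ K (fun e b => aeval (θ F n R β ℓ K Kw e b) g * zmon F n R β K b),
    Finset.sum_comm]
  refine Finset.sum_congr rfl fun b _ => ?_
  rw [Finset.sum_mul]

variable {F} in
/-- The coordinate polynomial of index `idx` carried by the Def. 1.3 witness:
`c_idx = ∑ₑ g(x, e, bits(idx))` (`= f_idx` for `idx < m`, Def. 1.3; a junk value beyond).
[cite: Raz2010, Def. 1.3 (p. 142)] -/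
def cpoly (g : MvPolynomial ((Fin n ⊕ Fin ℓ) ⊕ Fin Kw) F) (idx : ℕ) : MvPolynomial (Fin n) F :=
  boolSum (bitSubst (σ := fun n => Fin n) n ℓ Kw idx g)

/-- The coordinate polynomial, moved to the variables of `f̃`, is the `e`-sum of the substituted
witness (for `idx < 2^K`, whose bits beyond `K` vanish). [cite: Raz2010, Def. 1.3 (p. 142)] -/
theorem rename_inl_cpoly (g : MvPolynomial ((Fin n ⊕ Fin ℓ) ⊕ Fin Kw) F) {idx : ℕ}
    (hidx : idx < 2 ^ K) :
    rename Sum.inl (cpoly n ℓ Kw g idx) =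
      ∑ e : Fin ℓ → Bool, aeval (θ F n R β ℓ K Kw e (bitVec K idx)) g := by
  unfold cpoly boolSum
  rw [map_sum]
  refine Finset.sum_congr rfl fun e _ => ?_
  rw [← AlgHom.comp_apply, ← AlgHom.comp_apply]
  congr 1
  refine algHom_ext fun v => ?_
  rcases v with (i | j) | t
  · simp [bitSubst, θ]
  · simp only [AlgHom.comp_apply, bitSubst_X_inl, aeval_X, Sum.elim_inr, θ, bconst]
    split_ifs <;> simp
  · simp only [AlgHom.comp_apply, bitSubst_X_inr, aeval_X, θ, bconst, bbit_bitVec hidx]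
    split_ifs <;> simp

/-- **`f̃ = ∑_{idx < 2^K} c_idx(x) · Z_idx`** — the binary-block counterpart of Raz's definition
`f̃ᵢ = ∑_{j ∈ [m′]} f_{(j,i)}(x) · h⁻¹(j)` together with his Prop. 3.6 (`f̃` is, by its very
definition `tilde`, the Boolean sum of the small polynomial `witness`).
[cite: Raz2010, §3.3 (p. 159), Prop. 3.6 (pp. 160–161)] -/
theorem tilde_eq_sum (g : MvPolynomial ((Fin n ⊕ Fin ℓ) ⊕ Fin Kw) F) :
    tilde n R β ℓ K Kw g =
      ∑ idx : Fin (2 ^ K), rename Sum.inl (cpoly n ℓ Kw g idx) * zmon F n R β K (bitVec K idx) := by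
  rw [tilde_eq_sum_boolVec, sum_boolVec_eq_sum_fin]
  refine Finset.sum_congr rfl fun idx _ => ?_
  rw [rename_inl_cpoly F n R β ℓ K Kw g idx.isLt]

end OneLevel


/-! ### The rôle of Prop. 3.5: block sums after the substitution `x := a` -/

section BlockSum

variable {S : Type u} [CommSemiring S] (n R β : ℕ) {K : ℕ}

/-- The value of `Z_b` at a position: `1` at `(t, block_t)`, `0` elsewhere. [folklore] -/
theorem zexpZ_apply (b : Fin K → Bool) (t : Fin R) (c : Fin (2 ^ β)) :
    zexpZ R β K b (t, c) = if c = digit β b t then 1 else 0 := by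
  unfold zexpZ
  rw [Finsupp.finsetSum_apply, Finset.sum_eq_single t]
  · simp only [Finsupp.single_apply, Prod.mk.injEq, true_and]
    split_ifs with h1 h2 h2
    · rfl
    · exact absurd h1.symm h2
    · exact absurd h2.symm h1
    · rfl
  · intro t' _ ht'
    rw [Finsupp.single_apply, if_neg]
    exact fun h => ht' (Prod.mk.inj h).1
  · intro ht
    exact absurd (Finset.mem_univ t) ht

/-- `Z_b` has degree `R` (one variable per block). [cite: Raz2010, §3.3 (p. 159)] -/
theorem degree_zexpZ (b : Fin K → Bool) : (zexpZ R β K b).degree = R := by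
  classical
  rw [Finsupp.degree_eq_sum, Fintype.sum_prod_type]
  simp only [zexpZ_apply, Finset.sum_ite_eq', Finset.mem_univ, if_true, Finset.sum_const,
    Finset.card_univ, Fintype.card_fin, smul_eq_mul, mul_one]

/-- **Distinct indices select distinct monomials** as soon as `K ≤ R β` (all `K` index bits lie
in the first `R` blocks). [folklore] -/
theorem zexpZ_injective (hK : K ≤ R * β) :
    Function.Injective fun idx : Fin (2 ^ K) => zexpZ R β K (bitVec K idx) := by
  intro idx idx' h
  have hb : bitVec K idx = bitVec K idx' := by
    refine bitVec_eq_of_digit_eq hK fun t ht => ?_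
    have key := congrArg (fun e : (Fin R × Fin (2 ^ β)) →₀ ℕ => e (⟨t, ht⟩, digit β (bitVec K idx) t)) h
    dsimp only at key
    rw [zexpZ_apply, zexpZ_apply, if_pos rfl] at key
    by_cases h' : digit β (bitVec K idx) t = digit β (bitVec K idx') t
    · exact h'
    · rw [if_neg h'] at key
      exact absurd key one_ne_zero
  exact Fin.ext (bitVec_injOn idx.isLt idx'.isLt hb)

/-- The block sum `∑_{idx < 2^K} c_idx(x) · Z_idx ∈ S[X, Z]` of a family of coordinate
polynomials `c_idx ∈ S[X]` (`f̃` has this form, `tilde_eq_blockSum`; after a base change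
`S = G ⊇ F` so does its image). [cite: Raz2010, §3.3 (p. 159)] -/
def blockSum (c : Fin (2 ^ K) → MvPolynomial (Fin n) S) : MvPolynomial (XZ n R β) S :=
  ∑ idx : Fin (2 ^ K),
    rename Sum.inl (c idx) * rename Sum.inr (monomial (zexpZ R β K (bitVec K idx)) 1)

/-- `f̃` is the block sum of its coordinate polynomials `c_idx = ∑ₑ g(x, e, bits idx)`.
[cite: Raz2010, §3.3 (p. 159)] -/
theorem tilde_eq_blockSum {F : Type u} [CommRing F] (ℓ Kw : ℕ)
    (g : MvPolynomial ((Fin n ⊕ Fin ℓ) ⊕ Fin Kw) F) :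
    tilde n R β ℓ K Kw g = blockSum n R β fun idx : Fin (2 ^ K) => cpoly n ℓ Kw g idx :=
  tilde_eq_sum F n R β ℓ K Kw g

/-- Block sums are compatible with a change of coefficients. [folklore] -/
theorem map_blockSum {S' : Type*} [CommSemiring S'] (φ : S →+* S')
    (c : Fin (2 ^ K) → MvPolynomial (Fin n) S) :
    MvPolynomial.map φ (blockSum n R β c) = blockSum n R β fun idx => MvPolynomial.map φ (c idx) := by
  unfold blockSum
  rw [map_sum]
  refine Finset.sum_congr rfl fun idx _ => ?_
  rw [map_mul, map_rename, map_rename, map_monomial, map_one]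

/-- The block sum after the substitution `x := a` (Raz's `f̃|_a ∈ S[Z]`).
[cite: Raz2010, §3.3 (p. 160)] -/
def blockSumAt (c : Fin (2 ^ K) → MvPolynomial (Fin n) S) (a : Fin n → S) :
    MvPolynomial (Fin R × Fin (2 ^ β)) S :=
  aeval (Sum.elim (C ∘ a) X) (blockSum n R β c)

/-- `f̃|_a = ∑_idx c_idx(a) · Z_idx` (Raz 2010, proof of Prop. 3.5).
[cite: Raz2010, Prop. 3.5 (p. 160)] -/
theorem blockSumAt_eq_sum (c : Fin (2 ^ K) → MvPolynomial (Fin n) S) (a : Fin n → S) :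
    blockSumAt n R β c a =
      ∑ idx : Fin (2 ^ K), monomial (zexpZ R β K (bitVec K idx)) (eval a (c idx)) := by
  unfold blockSumAt blockSum
  simp only [map_sum, map_mul, aeval_rename, Sum.elim_comp_inl, Sum.elim_comp_inr,
    aeval_X_left_apply, aeval_C_comp_left, C_mul_monomial, mul_one]
  exact Finset.sum_congr rfl fun j _ => congrArg _ (congrFun (aeval_eq_eval (f := a)) (c j))

/-- **Raz 2010, Prop. 3.5** (block form): the coefficient of `Z_idx` in `f̃|_a` is `c_idx(a)`
(for `K ≤ R β`, so that the `Z_idx` are distinct). [cite: Raz2010, Prop. 3.5 (p. 160)] -/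
theorem coeff_zexpZ_blockSumAt (hK : K ≤ R * β) (c : Fin (2 ^ K) → MvPolynomial (Fin n) S)
    (a : Fin n → S) (idx : Fin (2 ^ K)) :
    coeff (zexpZ R β K (bitVec K idx)) (blockSumAt n R β c a) = eval a (c idx) := by
  classical
  rw [blockSumAt_eq_sum, coeff_sum, Finset.sum_eq_single idx]
  · rw [coeff_monomial, if_pos rfl]
  · intro j _ hj
    rw [coeff_monomial, if_neg ((zexpZ_injective R β hK).ne hj)]
  · intro h
    exact absurd (Finset.mem_univ idx) h

/-- **Raz 2010, Prop. 3.5** (block form): `f̃|_a ∈ 𝕄_R`, a form of degree `R`.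
[cite: Raz2010, Prop. 3.5 (p. 160)] -/
theorem isHomogeneous_blockSumAt (c : Fin (2 ^ K) → MvPolynomial (Fin n) S) (a : Fin n → S) :
    (blockSumAt n R β c a).IsHomogeneous R := by
  rw [blockSumAt_eq_sum]
  exact IsHomogeneous.sum _ _ _ fun idx _ => isHomogeneous_monomial _ (degree_zexpZ R β _)

end BlockSum

/-! ### Size and degree of the witness -/

section Bounds

variable {F : Type u} [CommRing F] (n R β ℓ K Kw : ℕ)

/-- Substituting polynomials of total degree `≤ 1` does not increase the total degree (same
statement and proof as the private helper of `RazElusiveGeneralRoute.lean`). [folklore] -/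
private theorem totalDegree_aeval_le_of_le_one'' {A : Type*} [CommSemiring A] {α τ : Type*}
    (h : α → MvPolynomial τ A) (hh : ∀ i, (h i).totalDegree ≤ 1) (g : MvPolynomial α A) :
    (aeval h g).totalDegree ≤ g.totalDegree := by
  conv_lhs => rw [g.as_sum]
  rw [map_sum]
  refine totalDegree_finsetSum_le fun d hd => ?_
  rw [aeval_monomial, ← C_eq_algebraMap]
  refine (totalDegree_mul _ _).trans ?_
  rw [totalDegree_C, zero_add, Finsupp.prod]
  refine (totalDegree_finsetProd _ _).trans ?_
  calc ∑ i ∈ d.support, (h i ^ d i).totalDegree ≤ ∑ i ∈ d.support, d i := by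
        gcongr with i
        calc (h i ^ d i).totalDegree ≤ d i * (h i).totalDegree := totalDegree_pow _ _
          _ ≤ d i * 1 := Nat.mul_le_mul_left _ (hh i)
          _ = d i := mul_one _
    _ ≤ g.totalDegree := le_totalDegree hd

/-- A bit literal is a variable or `0`: degree `≤ 1`. [folklore] -/
theorem totalDegree_wlit_le (i : ℕ) : (wlit F n R β ℓ K i).totalDegree ≤ 1 := by
  unfold wlit
  split_ifs
  · exact (totalDegree_monomial_le _ _).trans (by simp)
  · simp

/-- A bit literal is a variable or `0`: complexity `0`. [folklore] -/
theorem complexity_wlit (i : ℕ) : complexity (wlit F n R β ℓ K i) = 0 := by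
  unfold wlit
  split_ifs
  · exact complexity_X_holds _
  · rw [← C_0]; exact complexity_C_holds _

/-- A negated literal `1 - w` has degree `≤ 1`. [folklore] -/
theorem totalDegree_one_sub_wlit_le (i : ℕ) : (1 - wlit F n R β ℓ K i).totalDegree ≤ 1 :=
  (totalDegree_sub_C_le _ _).trans' (by
    rw [show (1 : MvPolynomial (WV n R β ℓ K) F) - wlit F n R β ℓ K i =
        -(wlit F n R β ℓ K i - C 1) by rw [C_1]; ring, totalDegree_neg])
    |>.trans (totalDegree_wlit_le n R β ℓ K i)

/-- A negated literal `1 - w = 1 + (-1)·w` costs at most `2` gates. [folklore] -/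
theorem complexity_one_sub_wlit_le (i : ℕ) : complexity (1 - wlit F n R β ℓ K i) ≤ 2 := by
  rw [sub_eq_add_neg, ← neg_one_smul F (wlit F n R β ℓ K i), ← C_1]
  calc complexity (C 1 + (-1 : F) • wlit F n R β ℓ K i)
      ≤ complexity (C (1 : F) : MvPolynomial (WV n R β ℓ K) F) +
          complexity ((-1 : F) • wlit F n R β ℓ K i) + 1 := complexity_add_le_holds _ _
    _ ≤ 0 + (complexity (wlit F n R β ℓ K i) + 1) + 1 := by
        gcongr
        · exact (complexity_C_holds (1 : F)).le
        · exact complexity_smul_le_holds _ _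
    _ = 2 := by rw [complexity_wlit]

/-- `deg IND ≤ β`. [folklore] -/
theorem totalDegree_ind_le (t : Fin R) (c : Fin (2 ^ β)) :
    (ind F n R β ℓ K t c).totalDegree ≤ β := by
  unfold ind
  refine (totalDegree_finsetProd _ _).trans ?_
  calc ∑ l : Fin β, (if (c : ℕ).testBit l then wlit F n R β ℓ K (t * β + l)
        else 1 - wlit F n R β ℓ K (t * β + l)).totalDegree ≤ ∑ _l : Fin β, 1 :=
        Finset.sum_le_sum fun l _ => by
          split_ifs
          · exact totalDegree_wlit_le n R β ℓ K _
          · exact totalDegree_one_sub_wlit_le n R β ℓ K _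
    _ = β := by simp

/-- `L(IND) ≤ 3β`. [folklore] -/
theorem complexity_ind_le (t : Fin R) (c : Fin (2 ^ β)) :
    complexity (ind F n R β ℓ K t c) ≤ 3 * β := by
  unfold ind
  refine (complexity_finset_prod_le _ _).trans ?_
  calc ∑ l : Fin β, complexity (if (c : ℕ).testBit l then wlit F n R β ℓ K (t * β + l)
        else 1 - wlit F n R β ℓ K (t * β + l)) + (Finset.univ : Finset (Fin β)).card
      ≤ ∑ _l : Fin β, 2 + (Finset.univ : Finset (Fin β)).card := by
        gcongr with l
        split_ifs
        · rw [complexity_wlit]; exact Nat.zero_le _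
        · exact complexity_one_sub_wlit_le n R β ℓ K _
    _ = 3 * β := by simp; ring

/-- `deg SEL ≤ R (β + 1)`. [folklore] -/
theorem totalDegree_sel_le : (sel F n R β ℓ K).totalDegree ≤ R * (β + 1) := by
  unfold sel
  refine (totalDegree_finsetProd _ _).trans ?_
  have hX : ∀ v : WV n R β ℓ K, (X v : MvPolynomial (WV n R β ℓ K) F).totalDegree ≤ 1 :=
    fun v => (totalDegree_monomial_le _ _).trans (by simp)
  have hterm : ∀ t : Fin R, (∑ c : Fin (2 ^ β), ind F n R β ℓ K t c *
      X (Sum.inl (Sum.inr (t, c)))).totalDegree ≤ β + 1 := fun t =>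
    totalDegree_finsetSum_le fun c _ => (totalDegree_mul _ _).trans
      (Nat.add_le_add (totalDegree_ind_le n R β ℓ K t c) (hX _))
  exact (Finset.sum_le_sum fun t _ => hterm t).trans (by simp)

/-- `L(SEL) ≤ R (2^β (3β + 2) + 1)`. [folklore] -/
theorem complexity_sel_le :
    complexity (sel F n R β ℓ K) ≤ R * (2 ^ β * (3 * β + 2) + 1) := by
  unfold sel
  refine (complexity_finset_prod_le _ _).trans ?_
  have hsum : ∀ t : Fin R, complexity (∑ c : Fin (2 ^ β),
      ind F n R β ℓ K t c * X (Sum.inl (Sum.inr (t, c)))) ≤ 2 ^ β * (3 * β + 2) := by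
    intro t
    refine (complexity_finset_sum_le _ _).trans ?_
    calc ∑ c : Fin (2 ^ β), complexity (ind F n R β ℓ K t c * X (Sum.inl (Sum.inr (t, c)))) +
          (Finset.univ : Finset (Fin (2 ^ β))).card
        ≤ ∑ _c : Fin (2 ^ β), (3 * β + 1) + (Finset.univ : Finset (Fin (2 ^ β))).card := by
          gcongr with c
          calc complexity (ind F n R β ℓ K t c * X (Sum.inl (Sum.inr (t, c))))
              ≤ complexity (ind F n R β ℓ K t c) +
                  complexity (X (Sum.inl (Sum.inr (t, c))) : MvPolynomial (WV n R β ℓ K) F) + 1 :=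
                complexity_mul_le_holds _ _
            _ ≤ 3 * β + 0 + 1 := by
                gcongr
                · exact complexity_ind_le n R β ℓ K t c
                · exact (complexity_X_holds _).le
      _ = 2 ^ β * (3 * β + 2) := by simp; ring
  calc ∑ t : Fin R, complexity (∑ c : Fin (2 ^ β), ind F n R β ℓ K t c * X (Sum.inl (Sum.inr (t, c)))) +
        (Finset.univ : Finset (Fin R)).card
      ≤ ∑ _t : Fin R, 2 ^ β * (3 * β + 2) + (Finset.univ : Finset (Fin R)).card := by
        gcongr with t; exact hsum t
    _ = R * (2 ^ β * (3 * β + 2) + 1) := by simp; ring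

/-- Feeding the Def. 1.3 witness is a projection (variables go to variables or to `0`).
[cite: Raz2010, Def. 1.3 (p. 142)] -/
theorem isProjection_aeval_ρ (g : MvPolynomial ((Fin n ⊕ Fin ℓ) ⊕ Fin Kw) F) :
    IsProjection (aeval (ρ F n R β ℓ K Kw) g) g := by
  refine ⟨ρ F n R β ℓ K Kw, fun v => ?_, rfl⟩
  rcases v with (i | j) | t
  · exact Or.inl ⟨_, rfl⟩
  · exact Or.inl ⟨_, rfl⟩
  · simp only [ρ, wlit]
    split_ifs
    · exact Or.inl ⟨_, rfl⟩
    · exact Or.inr ⟨0, C_0.symm⟩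

/-- **Size of the witness**: `L(g · SEL) ≤ L(g) + R (2^β (3β + 2) + 1) + 1`.
[cite: Raz2010, Prop. 3.6 (p. 160)] -/
theorem complexity_witness_le (g : MvPolynomial ((Fin n ⊕ Fin ℓ) ⊕ Fin Kw) F) :
    complexity (witness n R β ℓ K Kw g) ≤ complexity g + R * (2 ^ β * (3 * β + 2) + 1) + 1 := by
  unfold witness
  calc complexity (aeval (ρ F n R β ℓ K Kw) g * sel F n R β ℓ K)
      ≤ complexity (aeval (ρ F n R β ℓ K Kw) g) + complexity (sel F n R β ℓ K) + 1 :=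
        complexity_mul_le_holds _ _
    _ ≤ complexity g + R * (2 ^ β * (3 * β + 2) + 1) + 1 := by
        gcongr
        · exact complexity_le_of_isProjection (isProjection_aeval_ρ n R β ℓ K Kw g)
        · exact complexity_sel_le n R β ℓ K

/-- **Degree of the witness**: `deg (g · SEL) ≤ deg g + R (β + 1)`.
[cite: Raz2010, Prop. 3.6 (p. 160)] -/
theorem totalDegree_witness_le (g : MvPolynomial ((Fin n ⊕ Fin ℓ) ⊕ Fin Kw) F) :
    (witness n R β ℓ K Kw g).totalDegree ≤ g.totalDegree + R * (β + 1) := by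
  unfold witness
  refine (totalDegree_mul _ _).trans (Nat.add_le_add ?_ (totalDegree_sel_le n R β ℓ K))
  refine totalDegree_aeval_le_of_le_one'' _ (fun v => ?_) g
  rcases v with (i | j) | t
  · exact (totalDegree_monomial_le _ _).trans (by simp)
  · exact (totalDegree_monomial_le _ _).trans (by simp)
  · exact totalDegree_wlit_le n R β ℓ K t

end Bounds

/-! ### Parameter estimates -/

section Estimates

/-- `2^⌈log₂ x⌉ ≤ 2x + 1` (indeed `< 2x` for `x ≥ 1`). [folklore] -/
theorem two_pow_clog_le (x : ℕ) : 2 ^ Nat.clog 2 x ≤ 2 * x + 1 := by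
  rcases Nat.lt_or_ge 1 x with hx | hx
  · have h := Nat.pow_pred_clog_lt_self (b := 2) one_lt_two hx
    have hpos : 0 < Nat.clog 2 x := Nat.clog_pos one_lt_two hx
    have : 2 ^ Nat.clog 2 x = 2 * 2 ^ (Nat.clog 2 x).pred := by
      rw [← Nat.pow_succ', Nat.succ_pred_eq_of_pos hpos]
    omega
  · rw [Nat.clog_of_right_le_one hx]
    omega

/-- The number of index bits fits into `R` blocks of `2⌈log₂ 2n⌉` bits:
`⌈log₂ (n · C(n+R-1, R))⌉ ≤ R · 2⌈log₂ 2n⌉` for `1 ≤ R ≤ n` (since `C(n+R-1, R) ≤ (2n)^R` and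
`n ≤ (2n)^R`). [folklore] -/
theorem clog_index_le {n R : ℕ} (h1 : 1 ≤ R) (hR : R ≤ n) :
    Nat.clog 2 (n * Nat.choose (n + R - 1) R) ≤ R * (2 * Nat.clog 2 (2 * n)) := by
  apply Nat.clog_le_of_le_pow
  have h2n : 2 * n ≤ 2 ^ Nat.clog 2 (2 * n) := Nat.le_pow_clog one_lt_two _
  have hC : Nat.choose (n + R - 1) R ≤ (2 * n) ^ R :=
    (Nat.choose_le_pow _ _).trans (Nat.pow_le_pow_left (by omega) _)
  have hn : n ≤ (2 * n) ^ R := by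
    calc n ≤ 2 * n := by omega
      _ = (2 * n) ^ 1 := (pow_one _).symm
      _ ≤ (2 * n) ^ R := by
          rcases Nat.eq_zero_or_pos n with hn0 | hn0
          · subst hn0; simp
          · exact Nat.pow_le_pow_right (by omega) h1
  calc n * Nat.choose (n + R - 1) R ≤ (2 * n) ^ R * (2 * n) ^ R := Nat.mul_le_mul hn hC
    _ = (2 * n) ^ (2 * R) := by rw [← pow_add]; ring_nf
    _ ≤ (2 ^ Nat.clog 2 (2 * n)) ^ (2 * R) := Nat.pow_le_pow_left h2n _
    _ = 2 ^ (R * (2 * Nat.clog 2 (2 * n))) := by rw [← pow_mul]; ring_nf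

end Estimates

end RazBlocks

end Literature.Computability.AlgebraicComplexity
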